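import Summits.BirchSwinnertonDyer.BirchSwinnertonDyer.Theorems.CyclotomicUntwistNineEtaIntegrality
import Summits.BirchSwinnertonDyer.BirchSwinnertonDyer.Theorems.KolyvaginRoadThreeSchneiderTamAtThreeHeightLogNumeratorExactPFormalLog
import Literature.NumberTheory.EllipticCurves.PointCountHasseInvariantProofs
import Literature.NumberTheory.EllipticCurves.FormalGroupHasseInvariantProofs
import HarnessLib

/-!
# Route `CyclotomicUntwist`: `ClassesIndependent` holds UNCONDITIONALLY on every good model over `𝓞_{ℚ₃(ζ₉)}` with
# SUPERSINGULAR special fibre — the rank-`2` lower bound of Katz's module, by the Hasse invariant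

Cell `pub/bsd-wall` (D-0145 line `route-BirchSwinnertonDyer-CyclotomicUntwist`), prover seat `bsd-line-cycu-p5`
(gen 10), lane «the η-class is of the second kind», file 5 (the payoff). THEOREMS ONLY (no definition, no named fact,
no `sorry`); helper `--supports` K1 = stmt-BirchSwinnertonDyer-21580 (serves K2 = 21581 and the print input
`isDescendedFrobeniusMatrix_exists` of C2 = 27549, whose clause `∀ 𝓜, 𝓜.ClassesIndependent` is hereby a THEOREM on the
principal-series rows). BSD is not proved by this file and no crux is.

**`classesIndependent_of_three_dvd_specialFibreTrace`**: for every `W/ℚ`, every good model `𝓜 : W.NineGoodModel` and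
every reduction map `ρ` with `3 ∣ 𝓜.specialFibreTrace ρ` (supersingular special fibre), the Literature clause
`𝓜.ClassesIndependent` holds: no non-trivial `ℚ₃(ζ₉)`-combination of `[ω_W] = classOmega 𝓜` and `[η_W] = classEta 𝓜` has
bounded denominators. PROOF (elementary; Katz 1981 Thm 5.7.2's injectivity `H¹_dR ↪ D(Ê) ⊗ ℚ` for these models):
`a·[ω] + b·[η] = (b u)·(L_η + c·log)` up to `log`-terms; if `b = 0`, `NineLogUnbounded.eq_zero_of_hbd_C_mul_classOmega`;
if `b ≠ 0`, `HBD(L_η + c·log)` is EXACT (`NineEtaIntegrality.exists_map_eq_of_hbd`, resting on the integral coboundary of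
`L_η`, Parts I–III): `L_η + c·log = G ⊗ 1`, `G ∈ 𝓞⟦z⟧`. Reading `[z¹]`: `c ∈ 𝓞`. Reading `[z³]`:
`P₄ + c·ω₂ = (a₄ + 2a₁a₃) + c(a₁² + a₂) ∈ 3𝓞` (`coeff_four_formalXMulSq_mul_formalOmega`, tree `coeff_three_formalLog`);
reducing mod `ρ`, with the Hasse invariant `b̄₂ = ā₁² + ā₂ = 0` of the supersingular fibre (tree
`cast_card_add_one_sub_natCard_point`: `a ≡ A₃ = b₂ (mod 3)`): `ā₄ + 2ā₁ā₃ = 0`, so `b̄₄ = 2(ā₄ + 2ā₁ā₃) = 0` and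
`Δ̄ = −b̄₂²b̄₈ − 8b̄₄³ − 27b̄₆² + 9b̄₂b̄₄b̄₆ = 0` — contradicting the good (elliptic) special fibre.
[cite: Katz1981CrystallineDieudonne, Thm. 5.3.3 and Thm. 5.7.2] [cite: SilvermanAEC2009, V.4.1 and IV.1]
-/

set_option autoImplicit false
-- single-conjunct summit: `Summit.BirchSwinnertonDyer.BirchSwinnertonDyer.…` repeats the name by design
set_option linter.dupNamespace false

noncomputable section

open scoped Classical
open PowerSeries IsCyclotomicExtension Literature.NumberTheory.EllipticCurves
  Literature.NumberTheory.EllipticCurves.DescendedFrobenius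
  Summit.BirchSwinnertonDyer.BirchSwinnertonDyer.Theorems.NineIntegers
  Summit.BirchSwinnertonDyer.BirchSwinnertonDyer.Theorems.NineHondaEstimate
  Summit.BirchSwinnertonDyer.BirchSwinnertonDyer.Theorems.DescendedFrobeniusTransfer
  Summit.BirchSwinnertonDyer.BirchSwinnertonDyer.Theorems.NineHonda
  Summit.BirchSwinnertonDyer.BirchSwinnertonDyer.Theorems.NineLogUnbounded
  Summit.BirchSwinnertonDyer.Rank1Residual.X11b.RegMult

namespace Summit.BirchSwinnertonDyer.BirchSwinnertonDyer.Theorems.NineClassesIndependent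

/-! ## §1 Low coefficients: `z²x = 1 − a₁z − a₂z² − a₃z³ − (a₄ + a₁a₃)z⁴ + ⋯` and `P₄ = a₄ + 2a₁a₃` -/

section Coefficients

variable {R : Type*} [CommRing R] (W : WeierstrassCurve R)

/-- **`[z²](z²x) = −a₂`, `[z³](z²x) = −a₃`, `[z⁴](z²x) = −a₄ − a₁a₃`** (from `B·(z²x) = 1`, `B = w/z³ =
1 + a₁z + (a₁² + a₂)z² + ⋯`). [cite: SilvermanAEC2009, IV.1.1] -/
theorem coeff_formalXMulSq_two_three_four :
    coeff 2 W.formalXMulSq = -W.a₂ ∧ coeff 3 W.formalXMulSq = -W.a₃ ∧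
      coeff 4 W.formalXMulSq = -W.a₄ - W.a₁ * W.a₃ := by
  have h := W.formalWDivCube_mul_formalXMulSq
  have hB0 : coeff 0 W.formalWDivCube = 1 := by rw [coeff_zero_eq_constantCoeff]; exact W.constantCoeff_formalWDivCube
  have hT0 : coeff 0 W.formalXMulSq = 1 := by rw [coeff_zero_eq_constantCoeff]; exact W.constantCoeff_formalXMulSq
  have hB1 := Rung62310y1.coeff_one_formalWDivCube W
  have hB2 := Rung62310y1.coeff_two_formalWDivCube W
  have hB3 := KernelCert.coeff_three_formalWDivCube W
  have hB4 := HeightLogNumerator.coeff_four_formalWDivCube W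
  have hT1 := W.coeff_one_formalXMulSq
  have h2 := congrArg (coeff 2) h
  have h3 := congrArg (coeff 3) h
  have h4 := congrArg (coeff 4) h
  rw [PowerSeries.coeff_mul, Finset.Nat.sum_antidiagonal_succ, Finset.Nat.sum_antidiagonal_succ] at h2
  rw [PowerSeries.coeff_mul, Finset.Nat.sum_antidiagonal_succ, Finset.Nat.sum_antidiagonal_succ,
    Finset.Nat.sum_antidiagonal_succ] at h3
  rw [PowerSeries.coeff_mul, Finset.Nat.sum_antidiagonal_succ, Finset.Nat.sum_antidiagonal_succ,
    Finset.Nat.sum_antidiagonal_succ, Finset.Nat.sum_antidiagonal_succ] at h4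
  simp only [Finset.Nat.antidiagonal_zero, Finset.sum_singleton, zero_add, coeff_one, hB0, hB1, hB2, hB3, hB4, hT0,
    hT1] at h2 h3 h4
  norm_num at h2 h3 h4
  have e2 : coeff 2 W.formalXMulSq = -W.a₂ := by linear_combination h2
  have e3 : coeff 3 W.formalXMulSq = -W.a₃ := by rw [e2] at h3; linear_combination h3
  have e4 : coeff 4 W.formalXMulSq = -W.a₄ - W.a₁ * W.a₃ := by rw [e2, e3] at h4; linear_combination h4
  exact ⟨e2, e3, e4⟩

/-- **`P₄ = [z⁴](z²x·ω/dz) = a₄ + 2a₁a₃`** over a `ℚ`-algebra (`ω/dz = 1 + a₁z + (a₁² + a₂)z² +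
(a₁³ + 2a₁a₂ + 2a₃)z³ + (a₁⁴ + 3a₁²a₂ + 6a₁a₃ + a₂² + 2a₄)z⁴ + ⋯`). [cite: SilvermanAEC2009, IV.1.1] -/
theorem coeff_four_formalXMulSq_mul_formalOmega {A : Type*} [CommRing A] [Algebra ℚ A] (V : WeierstrassCurve A) :
    coeff 4 (V.formalXMulSq * V.formalOmega) = V.a₄ + 2 * V.a₁ * V.a₃ := by
  obtain ⟨hT2, hT3, hT4⟩ := coeff_formalXMulSq_two_three_four V
  have hT0 : coeff 0 V.formalXMulSq = 1 := by rw [coeff_zero_eq_constantCoeff]; exact V.constantCoeff_formalXMulSq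
  have hT1 := V.coeff_one_formalXMulSq
  have hω0 : coeff 0 V.formalOmega = 1 := by rw [coeff_zero_eq_constantCoeff]; exact V.constantCoeff_formalOmega
  have hω1 := Rung62310y1.coeff_one_formalOmega V
  have hω2 := Rung62310y1.coeff_two_formalOmega V
  have hω3 := KernelCert.coeff_three_formalOmega V
  have hω4 := HeightLogNumerator.coeff_four_formalOmega V
  rw [PowerSeries.coeff_mul, Finset.Nat.sum_antidiagonal_succ, Finset.Nat.sum_antidiagonal_succ,
    Finset.Nat.sum_antidiagonal_succ, Finset.Nat.sum_antidiagonal_succ]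
  simp only [Finset.Nat.antidiagonal_zero, Finset.sum_singleton, zero_add, hT0, hT1, hT2, hT3, hT4, hω0, hω1, hω2,
    hω3, hω4]
  ring

end Coefficients

/-! ## §2 The special fibre: supersingular `⇒ b̄₂ = 0` (Hasse); `b̄₂ = b̄₄ = 0 ⇒ Δ̄ = 0` in characteristic `3` -/

/-- **`a ≡ b₂ (mod 3)`** for an elliptic Weierstrass equation over `𝔽₃`: the trace `4 − #E(𝔽₃)` is the Hasse invariant
`A₃ = [x²]Ψ₂² = b₂` (AEC V.4.1(a), tree `cast_card_add_one_sub_natCard_point`). [cite: SilvermanAEC2009, V.4.1] -/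
theorem b₂_eq_zero_of_three_dvd (Ē : WeierstrassCurve (ZMod 3)) [Ē.IsElliptic]
    (h : (3 : ℤ) ∣ 4 - (Nat.card Ē.toAffine.Point : ℤ)) : Ē.b₂ = 0 := by
  have h2 : ringChar (ZMod 3) ≠ 2 := by rw [ZMod.ringChar_zmod_n]; decide
  have hH := Ē.cast_card_add_one_sub_natCard_point h2
  rw [ZMod.card] at hH
  norm_num at hH
  have h0 : (((4 : ℤ) - (Nat.card Ē.toAffine.Point : ℤ) : ℤ) : ZMod 3) = 0 :=
    (ZMod.intCast_zmod_eq_zero_iff_dvd _ 3).mpr h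
  have key : Ē.twoTorsionPolynomial.b = 0 := by
    rw [← hH]
    exact_mod_cast h0
  exact key

/-- In characteristic `3`: `b₂ = 0` and `a₄ + 2a₁a₃ = 0` force `Δ = 0` (`b₄ = 2(a₄ + 2a₁a₃) − 3a₁a₃`,
`Δ = −b₂²b₈ − 8b₄³ − 27b₆² + 9b₂b₄b₆`). [cite: SilvermanAEC2009, III.1] -/
theorem Δ_eq_zero_of_b₂_of_a₄ (Ē : WeierstrassCurve (ZMod 3)) (hb₂ : Ē.b₂ = 0) (h4 : Ē.a₄ + 2 * Ē.a₁ * Ē.a₃ = 0) :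
    Ē.Δ = 0 := by
  have hb₄ : Ē.b₄ = 0 := by
    rw [WeierstrassCurve.b₄]
    have h3 : (3 : ZMod 3) = 0 := rfl
    linear_combination 2 * h4 - Ē.a₁ * Ē.a₃ * h3
  rw [WeierstrassCurve.Δ, hb₂, hb₄]
  have h27 : (27 : ZMod 3) = 0 := rfl
  linear_combination (-Ē.b₆ ^ 2) * h27

/-! ## §3 The theorem -/

/-- **`ClassesIndependent` on every good model with supersingular special fibre (unconditional).** For `W/ℚ`, a good
model `𝓜 : W.NineGoodModel` over `𝓞_{ℚ₃(ζ₉)}` and a reduction map `ρ` with `3 ∣ 𝓜.specialFibreTrace ρ`: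
`𝓜.ClassesIndependent` — the classes `[ω_W], [η_W]` are `ℚ₃(ζ₉)`-linearly independent modulo series with bounded
denominators (the rank-`2` lower bound in Katz's `D(Ê/𝓞) ⊗ ℚ`; Katz 1981 Thm 5.7.2: `H¹_dR ↪ D(Ê)` with kernel the
unit-root part, which is `0` in the supersingular case). See the module docstring for the elementary proof.
[cite: Katz1981CrystallineDieudonne, Thm. 5.3.3 and Thm. 5.7.2] [cite: SilvermanAEC2009, V.4.1] -/
theorem classesIndependent_of_three_dvd_specialFibreTrace {W : WeierstrassCurve ℚ} (𝓜 : W.NineGoodModel)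
    (ρ : ONine →+* ZMod 3) (hss : (3 : ℤ) ∣ 𝓜.specialFibreTrace ρ) : 𝓜.ClassesIndependent := by
  haveI hell : (𝓜.E.map ρ).IsElliptic := isElliptic_specialFibre 𝓜 ρ
  intro a b hab
  set ι := algebraMap ONine KNine with hι
  set u : KNine := (𝓜.C.u : KNine) with hu
  set ui : KNine := ((𝓜.C.u⁻¹ : KNineˣ) : KNine) with hui
  have huui : u * ui = 1 := by rw [hu, hui, Units.mul_inv]
  have hu0 : u ≠ 0 := Units.ne_zero _
  -- the combination in terms of `log` and `L_η`
  have e : a • 𝓜.classOmega + b • 𝓜.classEta =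
      PowerSeries.C (b * u) * 𝓜.curve.formalEtaIntegral +
        PowerSeries.C (a * ui + b * 𝓜.C.r * ui) * 𝓜.curve.formalLog := by
    simp only [WeierstrassCurve.NineGoodModel.classOmega, WeierstrassCurve.NineGoodModel.classEta, smul_eq_C_mul,
      smul_add, map_add, map_mul, ← hu, ← hui]
    ring
  rw [e] at hab
  by_cases hb : b = 0
  · -- `b = 0`: `a·[ω]` has bounded denominators, so `a = 0`
    refine ⟨?_, hb⟩
    rw [hb, zero_mul, map_zero, zero_mul, zero_add, zero_mul, zero_mul, add_zero] at hab
    have hab' : HasBoundedDenominators (PowerSeries.C a * 𝓜.classOmega) := by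
      rw [WeierstrassCurve.NineGoodModel.classOmega, smul_eq_C_mul, ← mul_assoc, ← map_mul, ← hui]
      exact hab
    exact eq_zero_of_hbd_C_mul_classOmega 𝓜 ρ hab'
  · exfalso
    have hbu : b * u ≠ 0 := mul_ne_zero hb hu0
    set c : KNine := (a * ui + b * 𝓜.C.r * ui) * (b * u)⁻¹ with hc
    -- `L_η + c·log` has bounded denominators
    have hG : HasBoundedDenominators (𝓜.curve.formalEtaIntegral + PowerSeries.C c * 𝓜.curve.formalLog) := by
      have h := hbd_C_mul (b * u)⁻¹ hab
      have e' : PowerSeries.C (b * u)⁻¹ * (PowerSeries.C (b * u) * 𝓜.curve.formalEtaIntegral +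
          PowerSeries.C (a * ui + b * 𝓜.C.r * ui) * 𝓜.curve.formalLog) =
          𝓜.curve.formalEtaIntegral + PowerSeries.C c * 𝓜.curve.formalLog := by
        rw [hc, mul_add, ← mul_assoc, ← mul_assoc, ← map_mul, ← map_mul, inv_mul_cancel₀ hbu, map_one, one_mul,
          mul_comm ((b * u)⁻¹)]
      rw [e'] at h
      exact h
    -- hence it is EXACTLY integral
    obtain ⟨G, hGmap⟩ := NineEtaIntegrality.exists_map_eq_of_hbd 𝓜.E ρ c hG
    set 𝓔 := 𝓜.E.map ι with h𝓔
    -- `P = z²x·ω` of `𝓔` is the base change of `z²x · formalInvDiff` of `𝓜.E`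
    have hP : 𝓔.formalXMulSq * 𝓔.formalOmega = (𝓜.E.formalXMulSq * 𝓜.E.formalInvDiff).map ι := by
      rw [map_mul, WeierstrassCurve.map_formalXMulSq, WeierstrassCurve.map_formalInvDiff, ← h𝓔,
        WeierstrassCurve.formalInvDiff_eq_formalOmega]
    -- [z¹]: `c = ι c₀`
    have h1 := congrArg (coeff 1) hGmap
    rw [map_add, coeff_C_mul, WeierstrassCurve.coeff_one_formalLog, mul_one,
      FormalEtaResidue.coeff_one_formalEtaIntegral, hP, coeff_map, coeff_map] at h1
    set c₀ : ONine := coeff 1 G - coeff 2 (𝓜.E.formalXMulSq * 𝓜.E.formalInvDiff) with hc₀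
    have hcc₀ : c = ι c₀ := by
      rw [hc₀, map_sub]
      linear_combination h1
    -- [z³]: `P₄ + c·(a₁² + a₂) = 3·ι(g₃)`
    have hL3 : coeff 3 𝓔.formalEtaIntegral = algebraMap ℚ KNine (1 / 3) * (𝓔.a₄ + 2 * 𝓔.a₁ * 𝓔.a₃) := by
      have h : coeff 3 𝓔.formalEtaIntegral =
          algebraMap ℚ KNine (1 / (2 + 1 : ℚ)) * coeff 4 (𝓔.formalXMulSq * 𝓔.formalOmega) :=
        𝓔.coeff_succ_formalEtaIntegral 2
      rw [show (1 / (2 + 1 : ℚ)) = 1 / 3 by norm_num, coeff_four_formalXMulSq_mul_formalOmega] at h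
      exact h
    have h3 := congrArg (coeff 3) hGmap
    rw [map_add, coeff_C_mul, Rung62310y1.coeff_three_formalLog, hL3, coeff_map] at h3
    have hthird : algebraMap ℚ KNine (1 / 3) * 3 = 1 := by
      rw [show (3 : KNine) = algebraMap ℚ KNine 3 by norm_num, ← map_mul]; norm_num
    have h3' : 𝓔.a₄ + 2 * 𝓔.a₁ * 𝓔.a₃ + c * (𝓔.a₁ ^ 2 + 𝓔.a₂) = 3 * ι (coeff 3 G) := by
      linear_combination (3 : KNine) * h3 - (𝓔.a₄ + 2 * 𝓔.a₁ * 𝓔.a₃) * hthird - (c * (𝓔.a₁ ^ 2 + 𝓔.a₂)) * hthird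
    -- transport to `𝓞` and reduce mod `ρ`
    have h𝓞 : 𝓜.E.a₄ + 2 * 𝓜.E.a₁ * 𝓜.E.a₃ + c₀ * (𝓜.E.a₁ ^ 2 + 𝓜.E.a₂) = 3 * coeff 3 G := by
      apply Subtype.val_injective
      have e𝓔 : 𝓔.a₁ = ι 𝓜.E.a₁ ∧ 𝓔.a₂ = ι 𝓜.E.a₂ ∧ 𝓔.a₃ = ι 𝓜.E.a₃ ∧ 𝓔.a₄ = ι 𝓜.E.a₄ := by
        simp [h𝓔, WeierstrassCurve.map]
      obtain ⟨e1, e2, e3, e4⟩ := e𝓔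
      rw [e1, e2, e3, e4, hcc₀] at h3'
      simpa [hι, Subalgebra.algebraMap_eq] using h3'
    have hρ := congrArg ρ h𝓞
    simp only [map_add, map_mul, map_pow, map_ofNat, show (3 : ZMod 3) = 0 from rfl, zero_mul] at hρ
    -- the Hasse invariant of the supersingular special fibre
    set Ē := 𝓜.E.map ρ with hĒ
    have hb₂ : Ē.b₂ = 0 := by
      refine b₂_eq_zero_of_three_dvd Ē ?_
      simpa [WeierstrassCurve.NineGoodModel.specialFibreTrace, WeierstrassCurve.NineGoodModel.specialFibre, hĒ]
        using hss
    have hb₂' : Ē.a₁ ^ 2 + Ē.a₂ = 0 := by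
      rw [WeierstrassCurve.b₂] at hb₂
      have h3z : (3 : ZMod 3) = 0 := rfl
      linear_combination hb₂ - Ē.a₂ * h3z
    have ha : Ē.a₁ = ρ 𝓜.E.a₁ ∧ Ē.a₂ = ρ 𝓜.E.a₂ ∧ Ē.a₃ = ρ 𝓜.E.a₃ ∧ Ē.a₄ = ρ 𝓜.E.a₄ := by
      simp [hĒ, WeierstrassCurve.map]
    obtain ⟨ea1, ea2, ea3, ea4⟩ := ha
    have h4 : Ē.a₄ + 2 * Ē.a₁ * Ē.a₃ = 0 := by
      rw [ea1, ea3, ea4]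
      rw [ea1, ea2] at hb₂'
      linear_combination hρ - (ρ c₀) * hb₂'
    have hΔ := Δ_eq_zero_of_b₂_of_a₄ Ē hb₂ h4
    have hunit : IsUnit Ē.Δ := hell.isUnit
    rw [hΔ] at hunit
    exact not_isUnit_zero hunit

end Summit.BirchSwinnertonDyer.BirchSwinnertonDyer.Theorems.NineClassesIndependent

end
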